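import Summits.QuantumFields.YangMills.Theorems.LuscherReductionTwistedTraceScalingToronMinimality
import Literature.MathematicalPhysics.QuantumFieldTheory.ConstructiveQFTWave0
import Mathlib.Analysis.SpecialFunctions.Complex.CircleAddChar
import Mathlib.Analysis.InnerProductSpace.PiL2
import HarnessLib

/-!
# Twisted plane waves on the `L³` torus: the complex twisted curl `D_φ`, its action on plane waves `χ_j ⊗ ε ↦ χ_j ⊗ (q̂_j ∧ ε)`,
# plane-wave orthonormality, the Lagrange identity, and `‖q̂_j‖² = Σ_k (2 − 2cos(φ_k + 2πj_k/L)) = lap3`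
# (spectral-bridge brick C3a for the VALLEY term, crux `TwistedTraceScaling` stmt-QuantumFields-20203 S-BASE; design note
# `pub/ym-fleet/ym-luscher-20007-p1/COARSE-DESIGN.md` §12 (ii))

The covariant curl at a constant abelian background `V_θ` (`…ToronCurl.covCurl_abelianCfg_apply`) is, in the charged colour plane
`(1,2) ≅ ℂ`, the COMPLEX TWISTED CURL with phases `φ = 2θ`:
`(D_φ w)(x; k<l) = w(x,k) + e^{iφ_k} w(x+e_k, l) − e^{iφ_l} w(x+e_l, k) − w(x,l)` on `ℂ^{Edge}`, and the plain curl (`φ = 0`) in the neutral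
colour.  This file diagonalises the FORM `‖D_φ w‖²` by plane waves:
* `twCurl L φ : EuclideanSpace ℂ (Edge 3 L) →ₗ[ℂ] EuclideanSpace ℂ (Plaquette 3 L)`, `twCurl_apply`;
* `pw L j x = Π_k e^{2πi j_k x_k/L}` (product of Mathlib's `ZMod.stdAddChar`): `pw_shift`, `conj_pw_mul_pw`, ★ `sum_conj_pw_mul_pw`
  (orthogonality `Σ_x conj(χ_j)χ_{j'} = L³δ`);
* `qhat L φ j : ℂ³`, `(q̂)_k = e^{iφ_k}e^{2πi j_k/L} − 1`; ★ `norm_qhat_sq : ‖q̂‖² = lap3 L φ (val ∘ j)`;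
* `planeWave L j ε`, `planeWaveP L j η` (normalised), `wedge q ε` (`(q∧ε)_{kl} = q_k ε_l − q_l ε_k`): ★ `twCurl_planeWave :
  D_φ(χ_j ⊗ ε) = χ_j ⊗ (q̂_j ∧ ε)`, ★ `inner_planeWave(P)` (orthonormality), ★ `inner_wedge` (Lagrange:
  `⟪q∧ε, q∧ε'⟫ = ‖q‖²⟪ε,ε'⟫ − ⟪ε,q⟫⟪q,ε'⟫`), hence ★★ `inner_twCurl_planeWave`.

HONEST FRAMING: finite Fourier analysis at fixed `L`; femto rung R2b1 (brick for a stub of a child of a CONDITIONAL route); not a gap, not Clay.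
-/

set_option autoImplicit false

noncomputable section

open Finset
open scoped BigOperators ComplexConjugate InnerProductSpace
open Literature.MathematicalPhysics.QuantumFieldTheory

namespace Summit.QuantumFields.YangMills.Theorems.FemtoTransferGap.TwoLattice.Toron

open Summit.QuantumFields.YangMills.Theorems.FemtoTransferGap

variable (L : ℕ) [NeZero L]

/-! ## §1 The complex twisted curl -/

/-- Twist phase factor `e^{iφ_k}` of direction `k`. [folklore] -/
def twPhase (φ : Fin 3 → ℝ) (k : Fin 3) : ℂ := Complex.exp ((φ k : ℂ) * Complex.I)

/-- The raw complex twisted curl on functions: `(D_φ w)(x;k<l) = w(x,k) + e^{iφ_k}w(x+e_k,l) − e^{iφ_l}w(x+e_l,k) − w(x,l)`.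
[cite: Luscher1983, §3] -/
def twCurlFun (φ : Fin 3 → ℝ) : (Edge 3 L → ℂ) →ₗ[ℂ] (Plaquette 3 L → ℂ) where
  toFun w q := w (q.1, q.2.1.1) + twPhase φ q.2.1.1 * w (q.1.shift q.2.1.1, q.2.1.2)
    - twPhase φ q.2.1.2 * w (q.1.shift q.2.1.2, q.2.1.1) - w (q.1, q.2.1.2)
  map_add' v w := by funext q; simp only [Pi.add_apply]; ring
  map_smul' r v := by funext q; simp only [Pi.smul_apply, smul_eq_mul, RingHom.id_apply]; ring

/-- **The complex twisted curl** `D_φ : ℂ^{Edge} → ℂ^{Plaquette}` (Euclidean structures). [cite: Luscher1983, §3] -/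
def twCurl (φ : Fin 3 → ℝ) : EuclideanSpace ℂ (Edge 3 L) →ₗ[ℂ] EuclideanSpace ℂ (Plaquette 3 L) :=
  (WithLp.linearEquiv 2 ℂ (Plaquette 3 L → ℂ)).symm.toLinearMap ∘ₗ twCurlFun L φ ∘ₗ
    (WithLp.linearEquiv 2 ℂ (Edge 3 L → ℂ)).toLinearMap

omit [NeZero L] in
/-- Components of the twisted curl. [cite: Luscher1983, §3] -/
theorem twCurl_apply (φ : Fin 3 → ℝ) (w : EuclideanSpace ℂ (Edge 3 L)) (x : Site 3 L) (kl : {q : Fin 3 × Fin 3 // q.1 < q.2}) :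
    twCurl L φ w (x, kl) = w (x, kl.1.1) + twPhase φ kl.1.1 * w (x.shift kl.1.1, kl.1.2)
      - twPhase φ kl.1.2 * w (x.shift kl.1.2, kl.1.1) - w (x, kl.1.2) := by
  simp [twCurl, twCurlFun]

/-! ## §2 Plane-wave characters of `(ℤ/L)³` -/

/-- The plane-wave character with momentum label `j`: `χ_j(x) = Π_k e^{2πi j_k x_k/L}`. [folklore] -/
def pw (j x : Site 3 L) : ℂ := ∏ k, ZMod.stdAddChar (j k * x k)

/-- `χ_0 = 1`. [folklore] -/
theorem pw_zero_left (x : Site 3 L) : pw L 0 x = 1 := by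
  simp [pw]

/-- Translation covariance: `χ_j(x + e_k) = χ_j(x) · e^{2πi j_k/L}`. [folklore] -/
theorem pw_shift (j x : Site 3 L) (k : Fin 3) : pw L j (x.shift k) = pw L j x * ZMod.stdAddChar (j k) := by
  unfold pw Site.shift
  have h : ∀ k', ZMod.stdAddChar (j k' * (x + Pi.single k 1 : Site 3 L) k') =
      ZMod.stdAddChar (j k' * x k') * ZMod.stdAddChar (j k' * Pi.single (M := fun _ => ZMod L) k 1 k') := fun k' => by
    rw [Pi.add_apply, mul_add, AddChar.map_add_eq_mul]
  simp_rw [h, prod_mul_distrib]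
  congr 1
  rw [Fintype.prod_eq_single k (fun k' hk' => by rw [Pi.single_eq_of_ne hk', mul_zero, AddChar.map_zero_eq_one])]
  rw [Pi.single_eq_same, mul_one]

/-- `conj(e^{2πi a/L}) = e^{−2πi a/L}`. [folklore] -/
theorem conj_stdAddChar (a : ZMod L) : conj (ZMod.stdAddChar a) = ZMod.stdAddChar (-a) := by
  rw [ZMod.stdAddChar_apply, ZMod.stdAddChar_apply, AddChar.map_neg_eq_inv, Circle.coe_inv_eq_conj]

/-- `conj(χ_j(x))·χ_{j'}(x) = χ_{j'−j}(x)`. [folklore] -/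
theorem conj_pw_mul_pw (j j' x : Site 3 L) : conj (pw L j x) * pw L j' x = pw L (j' - j) x := by
  unfold pw
  rw [map_prod, ← prod_mul_distrib]
  refine prod_congr rfl fun k _ => ?_
  rw [conj_stdAddChar, ← AddChar.map_add_eq_mul, Pi.sub_apply]
  congr 1; ring

/-- Character sums: `Σ_x χ_m(x) = L³·[m = 0]`. [folklore] -/
theorem sum_pw (m : Site 3 L) : ∑ x, pw L m x = if m = 0 then ((L : ℂ)) ^ 3 else 0 := by
  unfold pw
  rw [← Fintype.prod_sum (fun k (y : ZMod L) => ZMod.stdAddChar (m k * y))]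
  have h : ∀ k, ∑ y : ZMod L, ZMod.stdAddChar (m k * y) = if m k = 0 then (L : ℂ) else 0 := fun k => by
    simp_rw [mul_comm (m k)]
    rw [AddChar.sum_mulShift (m k) (ZMod.isPrimitive_stdAddChar L), ZMod.card]
    split_ifs <;> simp
  simp_rw [h]
  split_ifs with hm
  · simp [hm]
  · obtain ⟨k, hk⟩ := Function.ne_iff.mp hm
    have hk' : ¬ m k = 0 := by simpa using hk
    exact prod_eq_zero (mem_univ k) (if_neg hk')

/-- ★ **Plane-wave orthogonality**: `Σ_x conj(χ_j(x))·χ_{j'}(x) = L³·[j = j']`. [folklore] -/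
theorem sum_conj_pw_mul_pw (j j' : Site 3 L) : ∑ x, conj (pw L j x) * pw L j' x = if j = j' then ((L : ℂ)) ^ 3 else 0 := by
  simp_rw [conj_pw_mul_pw, sum_pw, sub_eq_zero, eq_comm]

/-! ## §3 The symbol `q̂_j(φ)` and its length -/

/-- The twisted momentum symbol `(q̂_j)_k = e^{iφ_k}·e^{2πi j_k/L} − 1` as a vector of `ℂ³`. [cite: Luscher1983, §3] -/
def qhat (φ : Fin 3 → ℝ) (j : Site 3 L) : EuclideanSpace ℂ (Fin 3) :=
  WithLp.toLp 2 fun k => twPhase φ k * ZMod.stdAddChar (j k) - 1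

/-- Components of `q̂`. [folklore] -/
theorem qhat_apply (φ : Fin 3 → ℝ) (j : Site 3 L) (k : Fin 3) : qhat L φ j k = twPhase φ k * ZMod.stdAddChar (j k) - 1 := rfl

/-- `e^{iφ_k}·e^{2πi j_k/L} = exp(i(φ_k + 2π j_k.val/L))`. [folklore] -/
theorem twPhase_mul_stdAddChar (φ : Fin 3 → ℝ) (j : Site 3 L) (k : Fin 3) :
    twPhase φ k * ZMod.stdAddChar (j k) = Complex.exp (((φ k + 2 * Real.pi * ((j k).val : ℝ) / L : ℝ) : ℂ) * Complex.I) := by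
  rw [twPhase, ZMod.stdAddChar_apply, ZMod.toCircle_apply, ← Complex.exp_add]
  congr 1
  push_cast
  ring

/-- `|e^{it} − 1|² = 2 − 2cos t`. [folklore] -/
theorem norm_exp_mul_I_sub_one_sq (t : ℝ) : ‖Complex.exp ((t : ℂ) * Complex.I) - 1‖ ^ 2 = 2 - 2 * Real.cos t := by
  rw [Complex.sq_norm, Complex.normSq_apply, Complex.sub_re, Complex.sub_im, Complex.exp_ofReal_mul_I_re,
    Complex.exp_ofReal_mul_I_im, Complex.one_re, Complex.one_im, sub_zero]
  nlinarith [Real.cos_sq_add_sin_sq t]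

/-- ★ **Length of the symbol**: `‖q̂_j(φ)‖² = Σ_k (2 − 2cos(φ_k + 2π j_k/L))`. [cite: Luscher1983, §3] -/
theorem norm_qhat_sq (φ : Fin 3 → ℝ) (j : Site 3 L) :
    ‖qhat L φ j‖ ^ 2 = ∑ k, (2 - 2 * Real.cos (φ k + 2 * Real.pi * ((j k).val : ℝ) / L)) := by
  rw [EuclideanSpace.norm_sq_eq]
  refine sum_congr rfl fun k _ => ?_
  rw [qhat_apply, twPhase_mul_stdAddChar, norm_exp_mul_I_sub_one_sq]

/-- The same in the `lap3` vocabulary of `…ToronMinimality` (momentum index read through `ZMod.val`). [cite: Luscher1983, §3] -/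
theorem norm_qhat_sq_eq_lap3 (φ : Fin 3 → ℝ) (j : Site 3 L) :
    ‖qhat L φ j‖ ^ 2 = lap3 L φ (fun k => ⟨(j k).val, ZMod.val_lt (j k)⟩) := by
  rw [norm_qhat_sq]
  simp only [lap3, lap1]

/-! ## §4 Plane waves, the wedge, and the action of the twisted curl -/

/-- Plane-wave normalisation `c = (√(L³))⁻¹`. [folklore] -/
def pwc : ℝ := (Real.sqrt ((L : ℝ) ^ 3))⁻¹

/-- `c² · L³ = 1` (complex form `conj(c)·c·L³ = 1`). [folklore] -/
theorem conj_pwc_mul_pwc_mul : conj ((pwc L : ℝ) : ℂ) * ((pwc L : ℝ) : ℂ) * (L : ℂ) ^ 3 = 1 := by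
  rw [Complex.conj_ofReal, ← Complex.ofReal_mul]
  have hL : (0 : ℝ) < (L : ℝ) ^ 3 := by have := NeZero.pos L; positivity
  have h : pwc L * pwc L = ((L : ℝ) ^ 3)⁻¹ := by
    unfold pwc; rw [← mul_inv, Real.mul_self_sqrt hL.le]
  rw [h]; push_cast
  rw [inv_mul_cancel₀ (by exact_mod_cast hL.ne')]

/-- The plane wave `χ_j ⊗ ε` as a (normalised) complex link field: `(x,k) ↦ c·χ_j(x)·ε_k`. [cite: Luscher1983, §3] -/
def planeWave (j : Site 3 L) (ε : EuclideanSpace ℂ (Fin 3)) : EuclideanSpace ℂ (Edge 3 L) :=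
  WithLp.toLp 2 fun e => ((pwc L : ℝ) : ℂ) * pw L j e.1 * ε e.2

/-- The plaquette plane wave `χ_j ⊗ η`: `(x, kl) ↦ c·χ_j(x)·η_{kl}`. [cite: Luscher1983, §3] -/
def planeWaveP (j : Site 3 L) (η : EuclideanSpace ℂ {q : Fin 3 × Fin 3 // q.1 < q.2}) : EuclideanSpace ℂ (Plaquette 3 L) :=
  WithLp.toLp 2 fun p => ((pwc L : ℝ) : ℂ) * pw L j p.1 * η p.2

/-- The wedge `(q ∧ ε)_{kl} = q_k ε_l − q_l ε_k` (`k < l`). [folklore] -/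
def wedge (q ε : EuclideanSpace ℂ (Fin 3)) : EuclideanSpace ℂ {q : Fin 3 × Fin 3 // q.1 < q.2} :=
  WithLp.toLp 2 fun kl => q kl.1.1 * ε kl.1.2 - q kl.1.2 * ε kl.1.1

/-- Components of `planeWave`. [folklore] -/
theorem planeWave_apply (j : Site 3 L) (ε : EuclideanSpace ℂ (Fin 3)) (x : Site 3 L) (k : Fin 3) :
    planeWave L j ε (x, k) = ((pwc L : ℝ) : ℂ) * pw L j x * ε k := rfl

/-- Components of `planeWaveP`. [folklore] -/
theorem planeWaveP_apply (j : Site 3 L) (η : EuclideanSpace ℂ {q : Fin 3 × Fin 3 // q.1 < q.2}) (x : Site 3 L)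
    (kl : {q : Fin 3 × Fin 3 // q.1 < q.2}) : planeWaveP L j η (x, kl) = ((pwc L : ℝ) : ℂ) * pw L j x * η kl := rfl

/-- Components of `wedge`. [folklore] -/
theorem wedge_apply (q ε : EuclideanSpace ℂ (Fin 3)) (kl : {q : Fin 3 × Fin 3 // q.1 < q.2}) :
    wedge q ε kl = q kl.1.1 * ε kl.1.2 - q kl.1.2 * ε kl.1.1 := rfl

/-- ★ **The twisted curl of a plane wave** is the plane wave of the wedge with the symbol: `D_φ(χ_j ⊗ ε) = χ_j ⊗ (q̂_j(φ) ∧ ε)`.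
[cite: Luscher1983, §3] -/
theorem twCurl_planeWave (φ : Fin 3 → ℝ) (j : Site 3 L) (ε : EuclideanSpace ℂ (Fin 3)) :
    twCurl L φ (planeWave L j ε) = planeWaveP L j (wedge (qhat L φ j) ε) := by
  ext ⟨x, kl⟩
  rw [twCurl_apply, planeWaveP_apply, wedge_apply, planeWave_apply, planeWave_apply, planeWave_apply, planeWave_apply,
    pw_shift, pw_shift, qhat_apply, qhat_apply]
  ring

/-- ★ **Plane-wave orthonormality (links)**: `⟪χ_j ⊗ ε, χ_{j'} ⊗ ε'⟫ = [j = j']·⟪ε, ε'⟫`. [folklore] -/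
theorem inner_planeWave (j j' : Site 3 L) (ε ε' : EuclideanSpace ℂ (Fin 3)) :
    ⟪planeWave L j ε, planeWave L j' ε'⟫_ℂ = if j = j' then ⟪ε, ε'⟫_ℂ else 0 := by
  rw [PiLp.inner_apply, Fintype.sum_prod_type]
  simp_rw [planeWave_apply, RCLike.inner_apply, map_mul]
  have h : ∀ x : Site 3 L, ∑ k : Fin 3, ((pwc L : ℝ) : ℂ) * pw L j' x * ε' k * (conj ((pwc L : ℝ) : ℂ) * conj (pw L j x) * conj (ε k)) =
      (conj ((pwc L : ℝ) : ℂ) * ((pwc L : ℝ) : ℂ)) * (conj (pw L j x) * pw L j' x) * ∑ k : Fin 3, ε' k * conj (ε k) := fun x => by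
    rw [mul_sum]; exact sum_congr rfl fun k _ => by ring
  simp_rw [h, ← sum_mul, ← mul_sum, sum_conj_pw_mul_pw]
  split_ifs with hj
  · rw [conj_pwc_mul_pwc_mul, one_mul, PiLp.inner_apply]; rfl
  · simp

/-- ★ **Plane-wave orthonormality (plaquettes)**: `⟪χ_j ⊗ η, χ_{j'} ⊗ η'⟫ = [j = j']·⟪η, η'⟫`. [folklore] -/
theorem inner_planeWaveP (j j' : Site 3 L) (η η' : EuclideanSpace ℂ {q : Fin 3 × Fin 3 // q.1 < q.2}) :
    ⟪planeWaveP L j η, planeWaveP L j' η'⟫_ℂ = if j = j' then ⟪η, η'⟫_ℂ else 0 := by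
  rw [PiLp.inner_apply, Fintype.sum_prod_type]
  simp_rw [planeWaveP_apply, RCLike.inner_apply, map_mul]
  have h : ∀ x : Site 3 L, ∑ kl : {q : Fin 3 × Fin 3 // q.1 < q.2},
      ((pwc L : ℝ) : ℂ) * pw L j' x * η' kl * (conj ((pwc L : ℝ) : ℂ) * conj (pw L j x) * conj (η kl)) =
      (conj ((pwc L : ℝ) : ℂ) * ((pwc L : ℝ) : ℂ)) * (conj (pw L j x) * pw L j' x) *
        ∑ kl : {q : Fin 3 × Fin 3 // q.1 < q.2}, η' kl * conj (η kl) := fun x => by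
    rw [mul_sum]; exact sum_congr rfl fun k _ => by ring
  simp_rw [h, ← sum_mul, ← mul_sum, sum_conj_pw_mul_pw]
  split_ifs with hj
  · rw [conj_pwc_mul_pwc_mul, one_mul, PiLp.inner_apply]; rfl
  · simp

/-- The plaquette orientation `(0,1)`. [folklore] -/
def o01 : {q : Fin 3 × Fin 3 // q.1 < q.2} := ⟨(0, 1), by decide⟩

/-- The plaquette orientation `(0,2)`. [folklore] -/
def o02 : {q : Fin 3 × Fin 3 // q.1 < q.2} := ⟨(0, 2), by decide⟩

/-- The plaquette orientation `(1,2)`. [folklore] -/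
def o12 : {q : Fin 3 × Fin 3 // q.1 < q.2} := ⟨(1, 2), by decide⟩

/-- The three plaquette orientations `(0,1), (0,2), (1,2)` enumerate `{q : Fin 3 × Fin 3 // q.1 < q.2}`: a sum over them. [folklore] -/
theorem sum_orient (f : {q : Fin 3 × Fin 3 // q.1 < q.2} → ℂ) : ∑ kl, f kl = f o01 + f o02 + f o12 := by
  have huniv : (univ : Finset {q : Fin 3 × Fin 3 // q.1 < q.2}) = {o01, o02, o12} := by decide
  rw [huniv, sum_insert (by decide), sum_insert (by decide), sum_singleton, add_assoc]

/-- The wedge on the three orientations. [folklore] -/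
theorem wedge_o (q ε : EuclideanSpace ℂ (Fin 3)) :
    wedge q ε o01 = q 0 * ε 1 - q 1 * ε 0 ∧ wedge q ε o02 = q 0 * ε 2 - q 2 * ε 0 ∧ wedge q ε o12 = q 1 * ε 2 - q 2 * ε 1 :=
  ⟨rfl, rfl, rfl⟩

/-- ★ **Lagrange identity** for the wedge: `⟪q ∧ ε, q ∧ ε'⟫ = ‖q‖²·⟪ε, ε'⟫ − ⟪ε, q⟫·⟪q, ε'⟫`. [folklore] -/
theorem inner_wedge (q ε ε' : EuclideanSpace ℂ (Fin 3)) :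
    ⟪wedge q ε, wedge q ε'⟫_ℂ = ((‖q‖ ^ 2 : ℝ) : ℂ) * ⟪ε, ε'⟫_ℂ - ⟪ε, q⟫_ℂ * ⟪q, ε'⟫_ℂ := by
  have hq : ((‖q‖ ^ 2 : ℝ) : ℂ) = ∑ k, q k * conj (q k) := by
    rw [EuclideanSpace.norm_sq_eq, Complex.ofReal_sum]
    refine sum_congr rfl fun k _ => ?_
    rw [Complex.sq_norm, ← Complex.mul_conj]
  obtain ⟨h1, h2, h3⟩ := wedge_o q ε
  obtain ⟨h1', h2', h3'⟩ := wedge_o q ε'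
  rw [hq, PiLp.inner_apply, PiLp.inner_apply, PiLp.inner_apply, PiLp.inner_apply, sum_orient, h1, h2, h3, h1', h2', h3']
  simp only [RCLike.inner_apply, map_sub, map_mul, Fin.sum_univ_three]
  ring

/-- ★★ **The form of the twisted curl on plane waves**: `⟪D_φ(χ_j ⊗ ε), D_φ(χ_{j'} ⊗ ε')⟫ = [j = j']·(‖q̂_j‖²⟪ε,ε'⟫ − ⟪ε,q̂_j⟫⟪q̂_j,ε'⟫)`.
[cite: Luscher1983, §3] -/
theorem inner_twCurl_planeWave (φ : Fin 3 → ℝ) (j j' : Site 3 L) (ε ε' : EuclideanSpace ℂ (Fin 3)) :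
    ⟪twCurl L φ (planeWave L j ε), twCurl L φ (planeWave L j' ε')⟫_ℂ =
      if j = j' then ((‖qhat L φ j‖ ^ 2 : ℝ) : ℂ) * ⟪ε, ε'⟫_ℂ - ⟪ε, qhat L φ j⟫_ℂ * ⟪qhat L φ j, ε'⟫_ℂ else 0 := by
  rw [twCurl_planeWave, twCurl_planeWave, inner_planeWaveP]
  split_ifs with hj
  · subst hj; rw [inner_wedge]
  · rfl

end Summit.QuantumFields.YangMills.Theorems.FemtoTransferGap.TwoLattice.Toron

end
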